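import Summits.Schanuel.Schanuel.Theorems.RootDecomp1KGenusZeroNormShape

/-!
# RootDecomp1KM30LevelSet — lens 1, generation 72: the EXACT level set of `M30` (elementary, effective)

`M30 = (Y⁴ − Y³ − 6Y² + 2Y + 15) + x·(4Y² + Y − 27) + 11x²` (LIVENESS row 74; `RootDecomp1KSectorSubspace04` §8) is
DECIDED of record by the census certificate `RootDecomp1KGenusZeroNormShape` (`levelFinite_m30`, `thinFibreAt_m30`:
genus 0, conjugate poles, the tree's `2`-adic Ridout grade (B2b)) — a FINITENESS statement with no bound.  This file adds
the EXACT, EFFECTIVE level set: **no level point at any depth `N ≥ 4`** (`m30_no_level_point`), hence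
`LevelSet M30 C ⊆ {0,1,2,3}` (`levelSet_m30_subset`; depth `1`, `x = s₁ = 1`, `r = 1`, IS a level, and the census
instrument «ls3» (INSTRUMENT NOTE 63) finds no level point at `N ∈ {0, 2, 3}` — not claimed here), and a Ridout-free
proof of `LevelFinite M30` (`levelFinite_m30_elementary`).

MECHANISM.  By the tree's parametrisation `m30_normShape`, a level point at depth `N` with pencil parameter `t = A/B`
in lowest terms means `2^{N!}·W(a₁,b) = 4·p_N·(a₁² + 7b²)²` with `(a₁,b) = (A,−B)`,
`W = 3a₁⁴ − 4a₁³b + 94a₁²b² + 148a₁b³ + 159b⁴`, `p_N = psNumer 2 N`.  2-adic bookkeeping forces `a₁, b` odd,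
`a₁² + 7b² = 2^e·g` with `L + 4 = 2e + 2` (`L = N!`), `g` odd, `g ∣ 121`, in fact `g ∈ {1, 11}` (an `11`-adic step), and
the residual identity `W' = p_N·g²`, `W' = 2^{e−4}·g·Q' + 11·R` (`Q' = 3a₁² − 4a₁b + 73b²`, `R = b³(a₁ − 2b)`), whence
`32 ∣ 11R − g²` because `p_N ≡ 1 (mod 32)` for `N ≥ 4`.  The prime `2 = ω ω̄` SPLITS in the class-number-one order
`ℤ[ω]`, `ω = (1+√−7)/2` (`ω² = ω − 2`), whose units are `±1`: writing `a₁ = 2c + b`, `N(c + bω) = 2^m·g` with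
`m = e − 2` ODD `≥ 5` (parity from `4 ∣ N!`), the descent gives `c + bω = ω^m·η` or `ω̄^m·η`, `N(η) = g`, and along these
lines `c + 6b ≡ 0` resp. `c − 5b ≡ 0 (mod 32)` (`ω⁵ = 6 − ω`).  Then `32 ∣ 11R − g²` becomes `32 ∣ 143b⁴ + g²` resp.
`32 ∣ 99b⁴ − g²` — impossible, fourth powers of odd numbers being `1` or `17 (mod 32)`; the unit case `g = 1` on the
`ω`-branch uses the extra invariant `b ≡ ∓1 (mod 8)` along `±ω^{5+2k}`.  (`M30` carries infinitely many DYADIC points —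
every `c + bω = ±ω^m` gives one — so no purely local argument exists; the descent is the global input.)

ONE import (`…RootDecomp1KGenusZeroNormShape`, the certificate of record — cited, not re-proved), ONE namespace; no
`private`, no `instance`, no `set_option`, no notation, no sorry, no axiom beyond the standard three.  ×0 port (crit-1
PRICE NODE 32 (2), STATUS L3240); rung 0: nothing here proves Schanuel, 33364, 33363, 31077, 31987, `ThinFibre 2`, W4, DJ 2
or a binder.
-/

/-!
# RootDecomp1KM30LevelSet (part 01 of 02) — CENSUS PROVENANCE for lens-1 g72 NODE 32 REVISED «the EXACT level set of M30» (STATUS L3252; ERRATUM / K v2 L3258; the ×0 BONUS of CLAIM NODE 32 L3239 as priced by crit-1 (g13) PRICE NODE 32 L3240 (2) «WELCOME AS A ×0 PORT if sorry-free and stated against the TREE's predicates»; AUDIT / PORT GO L3255, AMENDED L3257 (3) «CONDITIONAL on ONE PROSE FIX» — met by K v2; main heads NOT ported — NO-GO L3240 (1): they are the census certificate `RootDecomp1KGenusZeroNormShape` p851056, imported here by name)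

(census-1 g27 ×0 record port, `--supports stmt-Schanuel-33364`, no credit to anyone.  SOURCE: the lens's kernel HOME/decomp-schanuel-lens-1/g72/lean/M30LevelSet.lean v2 sha256 6cd5aba0debc584d… (533 l; code byte-identical to v1 6c02827d930adf44…, two docstring sentences corrected per the census instrument ls3 / crit e32-2: the only level below 4 is N = 1, x = s₁ = 1; ONE import `…RootDecomp1KGenusZeroNormShape`; ONE namespace `…Theorems.RootDecomp1KM30LevelSet`; ONE section `M30Exact`; lens farm rc 0 · 0 sorries; critic AUDIT L3255: byte identity, farm rc 0 · 26 dupNamespace, `--axioms` standard on m30_no_level_point / levelSet_m30_subset / levelFinite_m30_elementary / m30_core / descent, probe rc 0 / CTRL rc 1, closure-walker: Ridout-free and Literature-free; census re-check of a byte copy rc 0 · 0 errors · 0 sorries) split by the census at the §2/§3 boundary for the 400-line cap: part 01 = K l.1–235 (module docstring, §1 the order ℤ[ω] as integer pairs — `mulW` / `mulWb` / `nrm` / `descent` / `mulW_iter5` / `lineW_inv` / `lineW_snd` / `mulWb_iter5` / `lineWb_inv` / `nrm_eq_one` —, §2 the residues mod 32 `res_a`…`res_e`) + the section / namespace closers;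 part 02 = K l.237–533 (§3 `m30_core`; §4 `psNumer_two_mod32`, `m30_no_level_point`, `levelSet_m30_subset`, `levelFinite_m30_elementary`) behind `import …RootDecomp1KM30LevelSet01` and the re-opened header (noncomputable section / namespace / opens / `section M30Exact` verbatim = K l.33–47).  Bodies BYTE-VERBATIM; nothing renamed, nothing privatised, no `set_option`; the ONLY port-side change is ten synthesised one-line docstrings in part 01 on the lens's undocumented `@[simp]` projections `mulW_fst` / `mulW_snd` / `mulWb_fst` / `mulWb_snd`, on `mulWb_mulW` and on `res_a`…`res_e` (gate lint.docstring).  Census instrument cross-check (LEVELSET-G0-v1 «ls3», INSTRUMENT NOTE 63 L3254; crit L3257 (2) confirmed N ≤ 3): LS(M30) ∩ [0,10] = {1} by two independent exact methods — with `m30_no_level_point` (every N ≥ 4) the EXACT level set of M30 is {1}.  Rung 0; nothing here proves Schanuel, 33364, 33363, 31077, 31987, `ThinFibre 2`, W4, DJ 2 or a binder; the decision OF RECORD for row 74 stays `…GenusZeroNormShape.thinFibreAt_m30` / `levelFinite_m30`.)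
-/

noncomputable section

namespace Summit.Schanuel.Schanuel.Theorems.RootDecomp1KM30LevelSet

open Polynomial LiouvilleNumber
open scoped Nat
open Summit.Schanuel.Schanuel.Theorems.RootDecomp1KTwoBaseCell (psNumer)
open Summit.Schanuel.Schanuel.Theorems.RootDecomp1KDegreeLadder (bev psNumer_succ')
open Summit.Schanuel.Schanuel.Theorems.RootDecomp1KSectorSubspace (boxP m30Box bev_m30)
open Summit.Schanuel.Schanuel.Theorems.RootDecomp1KLevelFinite (LevelSet LevelFinite le_of_pow_dvd_pow_mul_odd
  two_adic_decomp)
open Summit.Schanuel.Schanuel.Theorems.RootDecomp1KParamThueMahler (partialSum_two_eq_ratCast)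
open Summit.Schanuel.Schanuel.Theorems.RootDecomp1KGenusZeroNormShape (m30_normShape)

section M30Exact


/-! ### §1  The order `ℤ[ω]`, `ω = (1+√-7)/2` (`ω² = ω − 2`), as pairs `(c,d) ↔ c + dω` -/

/-- multiplication by `ω`: `(c + dω)·ω = −2d + (c+d)ω`. -/
def mulW (v : ℤ × ℤ) : ℤ × ℤ := (-2 * v.2, v.1 + v.2)

/-- multiplication by `ω̄ = 1 − ω`: `(c + dω)·ω̄ = (c + 2d) − cω`. -/
def mulWb (v : ℤ × ℤ) : ℤ × ℤ := (v.1 + 2 * v.2, -v.1)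

/-- the norm form `N(c + dω) = c² + cd + 2d²`. -/
def nrm (v : ℤ × ℤ) : ℤ := v.1 ^ 2 + v.1 * v.2 + 2 * v.2 ^ 2

/-- `(ω·(c + dω)).1 = −2d`. -/
@[simp] theorem mulW_fst (v : ℤ × ℤ) : (mulW v).1 = -2 * v.2 := rfl
/-- `(ω·(c + dω)).2 = c + d`. -/
@[simp] theorem mulW_snd (v : ℤ × ℤ) : (mulW v).2 = v.1 + v.2 := rfl
/-- `(ω̄·(c + dω)).1 = c + 2d`. -/
@[simp] theorem mulWb_fst (v : ℤ × ℤ) : (mulWb v).1 = v.1 + 2 * v.2 := rfl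
/-- `(ω̄·(c + dω)).2 = −c`. -/
@[simp] theorem mulWb_snd (v : ℤ × ℤ) : (mulWb v).2 = -v.1 := rfl

/-- `ω·ω̄ = 2`. -/
theorem mulW_mulWb (v : ℤ × ℤ) : mulW (mulWb v) = (2 * v.1, 2 * v.2) := by
  obtain ⟨c, d⟩ := v; simp only [mulW, mulWb, Prod.mk.injEq]; constructor <;> ring

/-- `ω̄·ω = 2`. -/
theorem mulWb_mulW (v : ℤ × ℤ) : mulWb (mulW v) = (2 * v.1, 2 * v.2) := by
  obtain ⟨c, d⟩ := v; simp only [mulW, mulWb, Prod.mk.injEq]; constructor <;> ring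

/-- **2-power descent in `ℤ[ω]`** (class number one, `2 = ω ω̄` split): a *primitive* pair of
norm `2^n · g` is `ω^n · η` or `ω̄^n · η` with `N(η) = g`. -/
theorem descent : ∀ (n : ℕ) (v : ℤ × ℤ) (g : ℤ), ¬ ((2:ℤ) ∣ v.1 ∧ (2:ℤ) ∣ v.2) →
    nrm v = 2 ^ n * g → ∃ η : ℤ × ℤ, nrm η = g ∧ (v = mulW^[n] η ∨ v = mulWb^[n] η)
  | 0, v, g, _, h => ⟨v, by simpa using h, Or.inl rfl⟩
  | n + 1, ⟨c, d⟩, g, hprim, h => by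
      change c ^ 2 + c * d + 2 * d ^ 2 = 2 ^ (n + 1) * g at h
      change ¬ ((2:ℤ) ∣ c ∧ (2:ℤ) ∣ d) at hprim
      have h2 : (2:ℤ) ∣ c * (c + d) := ⟨2 ^ n * g - d ^ 2, by linear_combination h⟩
      rcases Int.prime_two.dvd_mul.mp h2 with ⟨c', hc'⟩ | ⟨k, hk⟩
      · -- `ω ∣ v`:  `v = ω · (c' + d, −c')`
        have hd : ¬ (2:ℤ) ∣ d := fun hd => hprim ⟨⟨c', hc'⟩, hd⟩
        have hn' : nrm (c' + d, -c') = 2 ^ n * g := by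
          apply mul_left_cancel₀ (two_ne_zero : (2:ℤ) ≠ 0)
          rw [show (2:ℤ) * (2 ^ n * g) = 2 ^ (n + 1) * g by ring, ← h, hc']
          simp only [nrm]; ring
        have hprim' : ¬ ((2:ℤ) ∣ (c' + d, -c').1 ∧ (2:ℤ) ∣ (c' + d, -c').2) := by
          rintro ⟨h1, h2⟩
          change (2:ℤ) ∣ c' + d at h1; change (2:ℤ) ∣ -c' at h2
          exact hd (by omega)
        obtain ⟨η, hη, hor⟩ := descent n (c' + d, -c') g hprim' hn'
        refine ⟨η, hη, ?_⟩
        have hv : ((c, d) : ℤ × ℤ) = mulW (c' + d, -c') := by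
          simp only [mulW, Prod.mk.injEq]; constructor <;> omega
        rcases hor with hor | hor
        · left; rw [Function.iterate_succ_apply', ← hor]; exact hv
        · rcases n with _ | n
          · left
            rw [Function.iterate_zero_apply] at hor
            rw [Function.iterate_succ_apply', Function.iterate_zero_apply, ← hor]; exact hv
          · exfalso
            rw [Function.iterate_succ_apply'] at hor
            have h3 := hv; rw [hor, mulW_mulWb] at h3
            simp only [Prod.mk.injEq] at h3
            exact hprim ⟨⟨_, h3.1⟩, ⟨_, h3.2⟩⟩
      · -- `ω̄ ∣ v`: `c + d = 2k`, `v = ω̄ · (−d, k)`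
        by_cases hc2 : (2:ℤ) ∣ c
        · exact absurd ⟨hc2, by omega⟩ hprim
        have hcd : c = 2 * k - d := by omega
        have hn' : nrm (-d, k) = 2 ^ n * g := by
          apply mul_left_cancel₀ (two_ne_zero : (2:ℤ) ≠ 0)
          rw [show (2:ℤ) * (2 ^ n * g) = 2 ^ (n + 1) * g by ring, ← h, hcd]
          simp only [nrm]; ring
        have hprim' : ¬ ((2:ℤ) ∣ (-d, k).1 ∧ (2:ℤ) ∣ (-d, k).2) := by
          rintro ⟨h1, h2⟩
          change (2:ℤ) ∣ -d at h1; change (2:ℤ) ∣ k at h2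
          exact hc2 (by omega)
        obtain ⟨η, hη, hor⟩ := descent n (-d, k) g hprim' hn'
        refine ⟨η, hη, ?_⟩
        have hv : ((c, d) : ℤ × ℤ) = mulWb (-d, k) := by
          simp only [mulWb, Prod.mk.injEq]; constructor <;> omega
        rcases hor with hor | hor
        · rcases n with _ | n
          · right
            rw [Function.iterate_zero_apply] at hor
            rw [Function.iterate_succ_apply', Function.iterate_zero_apply, ← hor]; exact hv
          · exfalso
            rw [Function.iterate_succ_apply'] at hor
            have h3 := hv; rw [hor, mulWb_mulW] at h3
            simp only [Prod.mk.injEq] at h3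
            exact hprim ⟨⟨_, h3.1⟩, ⟨_, h3.2⟩⟩
        · right; rw [Function.iterate_succ_apply', ← hor]; exact hv

/-- `ω⁵ = 6 − ω`. -/
theorem mulW_iter5 (v : ℤ × ℤ) : mulW^[5] v = (6 * v.1 + 2 * v.2, -v.1 + 5 * v.2) := by
  simp only [Function.iterate_succ_apply', Function.iterate_zero_apply]
  obtain ⟨c, d⟩ := v
  simp only [mulW, Prod.mk.injEq]; constructor <;> ring

/-- along `ω^n η`, `n ≥ 5`: `c + 6d ≡ 0 (mod 32)`. -/
theorem lineW_inv (η : ℤ × ℤ) : ∀ n : ℕ, (32:ℤ) ∣ (mulW^[n + 5] η).1 + 6 * (mulW^[n + 5] η).2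
  | 0 => by
      rw [Nat.zero_add, mulW_iter5]
      exact ⟨η.2, by ring⟩
  | n + 1 => by
      obtain ⟨q, hq⟩ := lineW_inv η n
      rw [show n + 1 + 5 = (n + 5) + 1 from by ring, Function.iterate_succ_apply']
      simp only [mulW_fst, mulW_snd]
      exact ⟨6 * q - (mulW^[n + 5] η).2, by linear_combination 6 * hq⟩

/-- along `ω^{2k+5} η`: the `ω`-coordinate is constant mod `8`. -/
theorem lineW_snd (η : ℤ × ℤ) : ∀ k : ℕ, (8:ℤ) ∣ (mulW^[2 * k + 5] η).2 - (mulW^[5] η).2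
  | 0 => by simp
  | k + 1 => by
      obtain ⟨q, hq⟩ := lineW_inv η (2 * k)
      obtain ⟨s, hs⟩ := lineW_snd η k
      rw [show 2 * (k + 1) + 5 = (2 * k + 5) + 1 + 1 from by ring, Function.iterate_succ_apply',
        Function.iterate_succ_apply']
      simp only [mulW_fst, mulW_snd]
      exact ⟨4 * q - (mulW^[2 * k + 5] η).2 + s, by linear_combination hq + hs⟩

/-- `ω̄⁵ = 5 + ω`. -/
theorem mulWb_iter5 (v : ℤ × ℤ) : mulWb^[5] v = (5 * v.1 - 2 * v.2, v.1 + 6 * v.2) := by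
  simp only [Function.iterate_succ_apply', Function.iterate_zero_apply]
  obtain ⟨c, d⟩ := v
  simp only [mulWb, Prod.mk.injEq]; constructor <;> ring

/-- along `ω̄^n η`, `n ≥ 5`: `c − 5d ≡ 0 (mod 32)`. -/
theorem lineWb_inv (η : ℤ × ℤ) : ∀ n : ℕ, (32:ℤ) ∣ (mulWb^[n + 5] η).1 - 5 * (mulWb^[n + 5] η).2
  | 0 => by
      rw [Nat.zero_add, mulWb_iter5]
      exact ⟨-η.2, by ring⟩
  | n + 1 => by
      obtain ⟨q, hq⟩ := lineWb_inv η n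
      rw [show n + 1 + 5 = (n + 5) + 1 from by ring, Function.iterate_succ_apply']
      simp only [mulWb_fst, mulWb_snd]
      exact ⟨6 * q + (mulWb^[n + 5] η).2, by linear_combination 6 * hq⟩

/-- the units of `ℤ[ω]`: `N(c + dω) = 1 ⇒ c + dω = ±1`. -/
theorem nrm_eq_one {c d : ℤ} (h : c ^ 2 + c * d + 2 * d ^ 2 = 1) : d = 0 ∧ (c = 1 ∨ c = -1) := by
  have h4 : (2 * c + d) ^ 2 + 7 * d ^ 2 = 4 := by linear_combination 4 * h
  have hd1 : d ≤ 0 := by nlinarith [sq_nonneg (2 * c + d)]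
  have hd2 : 0 ≤ d := by nlinarith [sq_nonneg (2 * c + d)]
  have hd : d = 0 := le_antisymm hd1 hd2
  subst hd
  refine ⟨rfl, ?_⟩
  have : (c - 1) * (c + 1) = 0 := by linear_combination h
  rcases mul_eq_zero.mp this with h1 | h1
  · left; linarith
  · right; linarith

/-! ### §2  residues mod 32 (fourth powers of odd numbers are `1` or `17` mod `32`) -/

/-- `143·(8j − 1)⁴ + 1 ≢ 0 (mod 32)`. -/
theorem res_a (j : ℤ) : ¬ (32:ℤ) ∣ 143 * (8 * j - 1) ^ 4 + 1 ^ 2 := by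
  intro h
  have h' : (((143 * (8 * j - 1) ^ 4 + 1 ^ 2 : ℤ)) : ZMod 32) = 0 :=
    (ZMod.intCast_zmod_eq_zero_iff_dvd _ 32).mpr (by exact_mod_cast h)
  push_cast at h'
  generalize (j : ZMod 32) = J at h'
  revert J; decide

/-- `143·(8j + 1)⁴ + 1 ≢ 0 (mod 32)`. -/
theorem res_b (j : ℤ) : ¬ (32:ℤ) ∣ 143 * (8 * j + 1) ^ 4 + 1 ^ 2 := by
  intro h
  have h' : (((143 * (8 * j + 1) ^ 4 + 1 ^ 2 : ℤ)) : ZMod 32) = 0 :=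
    (ZMod.intCast_zmod_eq_zero_iff_dvd _ 32).mpr (by exact_mod_cast h)
  push_cast at h'
  generalize (j : ZMod 32) = J at h'
  revert J; decide

/-- `143·(2j + 1)⁴ + 11² ≢ 0 (mod 32)`. -/
theorem res_c (j : ℤ) : ¬ (32:ℤ) ∣ 143 * (2 * j + 1) ^ 4 + 11 ^ 2 := by
  intro h
  have h' : (((143 * (2 * j + 1) ^ 4 + 11 ^ 2 : ℤ)) : ZMod 32) = 0 :=
    (ZMod.intCast_zmod_eq_zero_iff_dvd _ 32).mpr (by exact_mod_cast h)
  push_cast at h'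
  generalize (j : ZMod 32) = J at h'
  revert J; decide

/-- `99·(2j + 1)⁴ − 1 ≢ 0 (mod 32)`. -/
theorem res_d (j : ℤ) : ¬ (32:ℤ) ∣ 99 * (2 * j + 1) ^ 4 - 1 ^ 2 := by
  intro h
  have h' : (((99 * (2 * j + 1) ^ 4 - 1 ^ 2 : ℤ)) : ZMod 32) = 0 :=
    (ZMod.intCast_zmod_eq_zero_iff_dvd _ 32).mpr (by exact_mod_cast h)
  push_cast at h'
  generalize (j : ZMod 32) = J at h'
  revert J; decide

/-- `99·(2j + 1)⁴ − 11² ≢ 0 (mod 32)`. -/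
theorem res_e (j : ℤ) : ¬ (32:ℤ) ∣ 99 * (2 * j + 1) ^ 4 - 11 ^ 2 := by
  intro h
  have h' : (((99 * (2 * j + 1) ^ 4 - 11 ^ 2 : ℤ)) : ZMod 32) = 0 :=
    (ZMod.intCast_zmod_eq_zero_iff_dvd _ 32).mpr (by exact_mod_cast h)
  push_cast at h'
  generalize (j : ZMod 32) = J at h'
  revert J; decide

end M30Exact

end Summit.Schanuel.Schanuel.Theorems.RootDecomp1KM30LevelSet
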